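import Mathlib
import Summits.ValiantsHypothesis.ValiantsHypothesis.Theses.ValuativeGCT
import Summits.ValiantsHypothesis.ValiantsHypothesis.Theorems.ValuativeGCTValuativeFlipFirstRungKroneckerGap
import Summits.ValiantsHypothesis.ValiantsHypothesis.Theorems.ValuativeGCTValuativeFlipKroneckerCensus

/-!
# `ValuativeGCT.ValuativeFlip` (stmt-ValiantsHypothesis-12624), det census — BLMW'S KRONECKER BOUND FOR `K_m` IS
# STRICT SOMEWHERE IN DEGREE 2, AT EVERY `m ≥ 3`

Det-orbit-closure multiplicity bound in the tree's named currency (wall-breaker axis "det-orbit-closure multiplicity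
bounds for the det census").  Bürgisser–Landsberg–Manivel–Weyman 2011, Prop. 5.2.1 (tree:
`Literature.….orbitMultiplicity_det_le_kroneckerCoeff_holds`): the multiplicity `K_m(λ*)` of `λ*` in `ℂ[Δ(det_m)]_δ` is at
most the rectangular Kronecker coefficient `g(λ, m×δ, m×δ)`.  Composing the first-rung strictness
`K_m(λ*) < dim T₀(λ*)` (`exists_orbitMultiplicity_det_lt_census`: valuative bound at the admissible corner centre + the
first-rung bite) with the Kronecker census `dim T₀(λ*) ≤ g(λ, m×δ, m×δ)` (`stub_truncT0_le_kronecker`, BLMW §5.2 /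
Fulton–Harris Lemma 6.23, landed by line skew-restriction-rank):

* `exists_orbitMultiplicity_det_lt_kroneckerCoeff` — for every `m ≥ 3` there is `λ ⊢ m · 2` (`≤ m²` parts) with
  `orbitMultiplicity ℂ (detFormLex ℂ m) m λ* < kroneckerCoeff ℂ λ (rectangle m 2) (rectangle m 2)`.

So BLMW's Kronecker upper bound for the determinant orbit closure is NOT attained somewhere in degree `2` at every size
`m ≥ 3` (BLMW §5 record the instance `m = 3`, type `(2,2,2)`: `K₃ = 0 < 1 = g`).

References: P. Bürgisser, J. M. Landsberg, L. Manivel, J. Weyman, SIAM J. Comput. 40 (2011) §5.2, Prop. 5.2.1 and the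
discussion of `m = 3` (arXiv:0907.2850 §5); C. Ikenmeyer, G. Panova, Adv. Math. 319 (2017) (rectangular Kronecker
coefficients in GCT).
-/

namespace Summit.ValiantsHypothesis.ValiantsHypothesis.Theorems.ValuativeFlip

open Literature.NumberTheory.DiophantineGeometry Literature.Computability.AlgebraicComplexity
open MvPolynomial
open scoped BigOperators Matrix

-- `Summit.ValiantsHypothesis.ValiantsHypothesis.…` is the tree's mandated single-conjunct layout (Sub = Summit).
set_option linter.dupNamespace false

noncomputable section

/-- **BLMW's Kronecker bound `K_m(λ*) ≤ g(λ, m×δ, m×δ)` is strict for some `λ ⊢ 2m`, at every `m ≥ 3`.**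
`exists_orbitMultiplicity_det_lt_census` (strictness against the census space) followed by
`stub_truncT0_le_kronecker` (census space `≤` rectangular Kronecker coefficient). [BLMW 2011 Prop. 5.2.1; folklore] -/
theorem exists_orbitMultiplicity_det_lt_kroneckerCoeff (m : ℕ) [NeZero m] (h3 : 3 ≤ m) :
    ∃ lam : Nat.Partition (m * 2), lam.parts.card ≤ m * m ∧
      orbitMultiplicity ℂ (detFormLex ℂ m) m ((Weight.dualOfPartition (m * m) lam).toMatIdx) <
        kroneckerCoeff ℂ lam (Nat.Partition.rectangle m 2) (Nat.Partition.rectangle m 2) := by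
  obtain ⟨lam, hcard, hlt⟩ := exists_orbitMultiplicity_det_lt_census m h3
  exact ⟨lam, hcard, lt_of_lt_of_le hlt (stub_truncT0_le_kronecker m 2 lam hcard)⟩

end

end Summit.ValiantsHypothesis.ValiantsHypothesis.Theorems.ValuativeFlip
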